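import Summits.CriticalPhenomena.PercolationContinuityZ3.Theorems.PercNearOneGluingNoHeavyLowerTailSunflowerMultiPetalKempeMarkedCharging
import HarnessLib
import HarnessLib.Audit

/-!
# `NoHeavyLowerTail` (crux stmt-CriticalPhenomena-4575), marked-multigraph layer: the charging map `ψ` and **THE HEART OF THEOREM L1**:
# `0 ≤ Σ_ρ resCell ρ` for `|S| ≥ 2`

Support file (seat `prim-l12-p2` gen 47; `--supports stmt-CriticalPhenomena-4575`; continuation of `…KempeMarkedCharging` (payer cells)).  No `sorry`;
nothing is asserted about the crux.  Memo: run/shared/lean/prim/prim-l12/prim-l12-p2/FINDING-g47-NEIGHBOURHOOD-CONTRACTION-STEP.md §3 STEP 3, §6 (ii).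

* `resCell_eq_neg_one_of_neg` — every deficit cell has residual exactly `−1`;
* `psi`, `psi_of_all`, `psi_of_D4`, `psi_of_D5` — the charging map (`Φ_u` on D1/D2, `s₀ ↦ 1` on D4, `Φ_u` then `s₀ ↦ 0` on D5) and its values;
* **`sum_resCell_nonneg`** — for terminals `u ≠ v`, an unmarked `y ∼ u` and `S = N(y) ∖ {u,v}` with `|S| ≥ 2`:  `0 ≤ Σ_{ρ u = 0, ρ v = 1} resCell ρ`.
  Proof: `ψ` is injective on the deficit cells (16-case pattern analysis of the images) and maps them to payer cells of residual `≥ 1`; the other cells are `≥ 0`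
  (p595450 `resCell_nonneg_of_profile` via p595736).  With `sum_resCell_eq` (p595450):  `T(K.isolate y) + allZeroSum ≤ 3·T(K)` — THEOREM L1 of the memo for
  `|S| ≥ 2`, up to the identification of `allZeroSum` with `T` of the contracted graph `K.peelContract y S u` (bookkeeping file to follow); `|S| = 0` is
  `pendant_pair_nonneg` (p593133), `|S| = 1` a separate small pairing.
-/

namespace Summit.CriticalPhenomena.PercolationContinuityZ3.Theorems.SunflowerPartition.Kempe

open Finset

namespace MGraph

variable {V : Type*} [Fintype V] [LinearOrder V] (K : MGraph V)

section Heart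

variable {K}
variable {u v y : V} {S : Finset V}

/-! ### The charging map and the heart of THEOREM L1 (|S| ≥ 2) -/

/-- In a deficit cell the residual is exactly `−1`. [this work] -/
theorem resCell_eq_neg_one_of_neg (hS : ∀ w, w ∈ S ↔ (w ≠ u ∧ w ≠ v ∧ w ≠ y ∧ K.mul y w ≠ 0)) (huv : u ≠ v) (hyu : y ≠ u) (hyv : y ≠ v)
    (hmy : K.mark y = 0) (hyu' : K.mul y u ≠ 0) (htwo : 2 ≤ S.card) (ρ : V → Fin 3) (hu : ρ u = 0) (hv : ρ v = 1)
    (hneg : K.resCell y S ρ < 0) : K.resCell y S ρ = -1 := by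
  have hne : S.Nonempty := card_pos.1 (by omega)
  have hcases := resCell_neg_cases hS huv hyu hyv hmy hyu' htwo ρ hu hv hneg
  -- in each family the cell is not all-0 and the kernel is ≥ −1 at its profile
  have key : ∀ (k : CType), (-1 ≤ kerTAbs ((K.isolate y).ctypeM ρ) k) → K.profM y ρ = k → ¬(∀ s ∈ S, ρ s = 0) → K.resCell y S ρ = -1 := by
    intro k hk hpk hnot
    unfold resCell at hneg ⊢
    rw [if_neg hnot, sub_zero, hpk] at hneg ⊢
    omega
  -- recompute the profile in each case (as in the classification)
  have hprof : ∀ c : Fin 3, K.linkM y ρ c = (if ρ u = c then K.mul y u else 0) + (if ρ v = c then K.mul y v else 0)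
      + ∑ s ∈ S, (if ρ s = c then K.mul y s else 0) := linkM_eq_outer hS huv hyu hyv ρ
  have hmu : 1 ≤ K.mul y u := Nat.one_le_iff_ne_zero.2 hyu'
  rcases hcases with ⟨hall, hu1, hv0, -⟩ | ⟨hall, hu1, -⟩ | ⟨s₀, hs₀, hc₀, hm₀, hrest, hv0, -⟩ | ⟨s₀, hs₀, hc₀, hm₀, hrest, hv0, -⟩
  · refine key (1, 0, 2) (kerTAbs_deficit_value _).1.1 ?_ ?_
    · have hA0 : (∑ s ∈ S, (if ρ s = 0 then K.mul y s else 0)) = 0 := sum_eq_zero fun s hs => by rw [hall s hs]; simp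
      have hA1 : (∑ s ∈ S, (if ρ s = 1 then K.mul y s else 0)) = 0 := sum_eq_zero fun s hs => by rw [hall s hs]; simp
      have hA2 := card_le_sumS hS ρ 2 hall
      unfold profM; simp only [hmy, add_zero]
      rw [hprof 0, hprof 1, hprof 2, if_pos hu, if_neg (by rw [hv]; decide), if_neg (by rw [hu]; decide), if_pos hv,
        if_neg (by rw [hu]; decide), if_neg (by rw [hv]; decide), hA0, hA1, hu1, hv0]
      refine Prod.ext rfl (Prod.ext rfl ?_)
      simp only [zero_add]; exact (two_le_iff_cap3 _).1 (by omega)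
    · obtain ⟨s, hs⟩ := hne; intro hh; have := hh s hs; rw [hall s hs] at this; exact absurd this (by decide)
  · refine key (1, 2, 0) (kerTAbs_deficit_value _).2.1.1 ?_ ?_
    · have hA0 : (∑ s ∈ S, (if ρ s = 0 then K.mul y s else 0)) = 0 := sum_eq_zero fun s hs => by rw [hall s hs]; simp
      have hA2 : (∑ s ∈ S, (if ρ s = 2 then K.mul y s else 0)) = 0 := sum_eq_zero fun s hs => by rw [hall s hs]; simp
      have hA1 := card_le_sumS hS ρ 1 hall
      unfold profM; simp only [hmy, add_zero]
      rw [hprof 0, hprof 1, hprof 2, if_pos hu, if_neg (by rw [hv]; decide), if_neg (by rw [hu]; decide), if_pos hv,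
        if_neg (by rw [hu]; decide), if_neg (by rw [hv]; decide), hA0, hA2, hu1]
      refine Prod.ext rfl (Prod.ext ?_ rfl)
      simp only [zero_add]; exact (two_le_iff_cap3 _).1 (by omega)
    · obtain ⟨s, hs⟩ := hne; intro hh; have := hh s hs; rw [hall s hs] at this; exact absurd this (by decide)
  · refine key (2, 0, 1) (kerTAbs_deficit_value _).2.2.1.1 ?_ ?_
    · obtain ⟨s₁, hs₁, hs₁ne⟩ : ∃ s₁ ∈ S, s₁ ≠ s₀ := by
        by_contra hno; push Not at hno
        have : S.card ≤ 1 := card_le_one.2 fun a ha b hb => by rw [hno a ha, hno b hb]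
        omega
      have hA0 : 1 ≤ ∑ s ∈ S, (if ρ s = 0 then K.mul y s else 0) := by
        have := single_le_sum (f := fun s => if ρ s = 0 then K.mul y s else 0) (fun s _ => Nat.zero_le _) hs₁
        simp only [hrest s₁ hs₁ hs₁ne, if_true] at this
        have := Nat.one_le_iff_ne_zero.2 ((hS s₁).1 hs₁).2.2.2
        omega
      have hA1 : (∑ s ∈ S, (if ρ s = 1 then K.mul y s else 0)) = 0 := sum_eq_zero fun s hs => by
        by_cases hss : s = s₀
        · rw [hss, hc₀]; simp
        · rw [hrest s hs hss]; simp
      have hA2 : (∑ s ∈ S, (if ρ s = 2 then K.mul y s else 0)) = 1 := by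
        rw [sum_eq_single_of_mem s₀ hs₀ (fun s hs hss => by rw [hrest s hs hss]; simp), if_pos hc₀, hm₀]
      unfold profM; simp only [hmy, add_zero]
      rw [hprof 0, hprof 1, hprof 2, if_pos hu, if_neg (by rw [hv]; decide), if_neg (by rw [hu]; decide), if_pos hv,
        if_neg (by rw [hu]; decide), if_neg (by rw [hv]; decide), hA1, hA2, hv0]
      refine Prod.ext ?_ (Prod.ext rfl rfl)
      simp only; exact (two_le_iff_cap3 _).1 (by omega)
    · intro hh; have := hh s₀ hs₀; rw [hc₀] at this; exact absurd this (by decide)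
  · refine key (2, 1, 0) (kerTAbs_deficit_value _).2.2.2.1 ?_ ?_
    · obtain ⟨s₁, hs₁, hs₁ne⟩ : ∃ s₁ ∈ S, s₁ ≠ s₀ := by
        by_contra hno; push Not at hno
        have : S.card ≤ 1 := card_le_one.2 fun a ha b hb => by rw [hno a ha, hno b hb]
        omega
      have hA0 : 1 ≤ ∑ s ∈ S, (if ρ s = 0 then K.mul y s else 0) := by
        have := single_le_sum (f := fun s => if ρ s = 0 then K.mul y s else 0) (fun s _ => Nat.zero_le _) hs₁
        simp only [hrest s₁ hs₁ hs₁ne, if_true] at this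
        have := Nat.one_le_iff_ne_zero.2 ((hS s₁).1 hs₁).2.2.2
        omega
      have hA1 : (∑ s ∈ S, (if ρ s = 1 then K.mul y s else 0)) = 1 := by
        rw [sum_eq_single_of_mem s₀ hs₀ (fun s hs hss => by rw [hrest s hs hss]; simp), if_pos hc₀, hm₀]
      have hA2 : (∑ s ∈ S, (if ρ s = 2 then K.mul y s else 0)) = 0 := sum_eq_zero fun s hs => by
        by_cases hss : s = s₀
        · rw [hss, hc₀]; simp
        · rw [hrest s hs hss]; simp
      unfold profM; simp only [hmy, add_zero]
      rw [hprof 0, hprof 1, hprof 2, if_pos hu, if_neg (by rw [hv]; decide), if_neg (by rw [hu]; decide), if_pos hv,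
        if_neg (by rw [hu]; decide), if_neg (by rw [hv]; decide), hA1, hA2, hv0]
      refine Prod.ext ?_ (Prod.ext rfl rfl)
      simp only; exact (two_le_iff_cap3 _).1 (by omega)
    · intro hh; have := hh s₀ hs₀; rw [hc₀] at this; exact absurd this (by decide)


/-- The CHARGING MAP `ψ` on colourings (memo §6 (ii)): `Φ_u` on the all-2 / all-1 cells, `s₀ ↦ 1` on the `all 0 but s₀ ↦ 2` cells, `Φ_u` then `s₀ ↦ 0`
on the `all 0 but s₀ ↦ 1` cells, identity elsewhere. [this work] -/
noncomputable def psi (u : V) (S : Finset V) (ρ : V → Fin 3) : V → Fin 3 := by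
  classical
  exact if (∀ s ∈ S, ρ s = 2) ∨ (∀ s ∈ S, ρ s = 1) then phiU u ρ
    else if h4 : ∃ s₀, s₀ ∈ S ∧ ρ s₀ = 2 ∧ ∀ s ∈ S, s ≠ s₀ → ρ s = 0 then Function.update ρ (Classical.choose h4) 1
    else if h5 : ∃ s₀, s₀ ∈ S ∧ ρ s₀ = 1 ∧ ∀ s ∈ S, s ≠ s₀ → ρ s = 0 then Function.update (phiU u ρ) (Classical.choose h5) 0
    else ρ

/-- `ψ` on an all-2 or all-1 cell is the swap. [this work] -/
theorem psi_of_all (ρ : V → Fin 3) (h : (∀ s ∈ S, ρ s = 2) ∨ (∀ s ∈ S, ρ s = 1)) : psi u S ρ = phiU u ρ := by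
  unfold psi; rw [if_pos h]

/-- `ψ` on an `all 0 but s₀ ↦ 2` cell recolours `s₀` to `1` (for `|S| ≥ 2`). [this work] -/
theorem psi_of_D4 (htwo : 2 ≤ S.card) (ρ : V → Fin 3) {s₀ : V} (hs₀ : s₀ ∈ S) (hc₀ : ρ s₀ = 2) (hrest : ∀ s ∈ S, s ≠ s₀ → ρ s = 0) :
    psi u S ρ = Function.update ρ s₀ 1 := by
  obtain ⟨s₁, hs₁, hs₁ne⟩ : ∃ s₁ ∈ S, s₁ ≠ s₀ := by
    by_contra hno; push Not at hno
    have : S.card ≤ 1 := card_le_one.2 fun a ha b hb => by rw [hno a ha, hno b hb]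
    omega
  have hno : ¬((∀ s ∈ S, ρ s = 2) ∨ (∀ s ∈ S, ρ s = 1)) := by
    rintro (h | h)
    · have := h s₁ hs₁; rw [hrest s₁ hs₁ hs₁ne] at this; exact absurd this (by decide)
    · have := h s₀ hs₀; rw [hc₀] at this; exact absurd this (by decide)
  have h4 : ∃ s, s ∈ S ∧ ρ s = 2 ∧ ∀ s' ∈ S, s' ≠ s → ρ s' = 0 := ⟨s₀, hs₀, hc₀, hrest⟩
  unfold psi; rw [if_neg hno, dif_pos h4]
  have hch := Classical.choose_spec h4
  have : Classical.choose h4 = s₀ := by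
    by_contra hne
    have := hrest _ hch.1 hne
    rw [hch.2.1] at this; exact absurd this (by decide)
  rw [this]

/-- `ψ` on an `all 0 but s₀ ↦ 1` cell swaps and recolours `s₀` to `0` (for `|S| ≥ 2`). [this work] -/
theorem psi_of_D5 (htwo : 2 ≤ S.card) (ρ : V → Fin 3) {s₀ : V} (hs₀ : s₀ ∈ S) (hc₀ : ρ s₀ = 1) (hrest : ∀ s ∈ S, s ≠ s₀ → ρ s = 0) :
    psi u S ρ = Function.update (phiU u ρ) s₀ 0 := by
  obtain ⟨s₁, hs₁, hs₁ne⟩ : ∃ s₁ ∈ S, s₁ ≠ s₀ := by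
    by_contra hno; push Not at hno
    have : S.card ≤ 1 := card_le_one.2 fun a ha b hb => by rw [hno a ha, hno b hb]
    omega
  have hno : ¬((∀ s ∈ S, ρ s = 2) ∨ (∀ s ∈ S, ρ s = 1)) := by
    rintro (h | h)
    · have := h s₀ hs₀; rw [hc₀] at this; exact absurd this (by decide)
    · have := h s₁ hs₁; rw [hrest s₁ hs₁ hs₁ne] at this; exact absurd this (by decide)
  have hno4 : ¬(∃ s, s ∈ S ∧ ρ s = 2 ∧ ∀ s' ∈ S, s' ≠ s → ρ s' = 0) := by
    rintro ⟨s, hs, hc, -⟩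
    by_cases hss : s = s₀
    · rw [hss, hc₀] at hc; exact absurd hc (by decide)
    · rw [hrest s hs hss] at hc; exact absurd hc (by decide)
  have h5 : ∃ s, s ∈ S ∧ ρ s = 1 ∧ ∀ s' ∈ S, s' ≠ s → ρ s' = 0 := ⟨s₀, hs₀, hc₀, hrest⟩
  unfold psi; rw [if_neg hno, dif_neg hno4, dif_pos h5]
  have hch := Classical.choose_spec h5
  have : Classical.choose h5 = s₀ := by
    by_contra hne
    have := hrest _ hch.1 hne
    rw [hch.2.1] at this; exact absurd this (by decide)
  rw [this]

/-- **THE HEART OF THEOREM L1** (memo §3; `|S| ≥ 2`): the cell residuals of the neighbourhood-contraction law sum to a nonnegative number —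
the deficit cells (value `−1`, families D1/D2/D4/D5) are charged injectively by `ψ` to payer cells of value `≥ 1`. [this work] -/
theorem sum_resCell_nonneg (hS : ∀ w, w ∈ S ↔ (w ≠ u ∧ w ≠ v ∧ w ≠ y ∧ K.mul y w ≠ 0)) (huv : u ≠ v) (hyu : y ≠ u) (hyv : y ≠ v)
    (hmy : K.mark y = 0) (hyu' : K.mul y u ≠ 0) (htwo : 2 ≤ S.card) :
    0 ≤ ∑ ρ ∈ univ.filter (fun ρ : V → Fin 3 => ρ u = 0 ∧ ρ v = 1), K.resCell y S ρ := by
  set F := univ.filter (fun ρ : V → Fin 3 => ρ u = 0 ∧ ρ v = 1) with hF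
  set D := F.filter (fun ρ => K.resCell y S ρ < 0) with hD
  have hne : S.Nonempty := card_pos.1 (by omega)
  have huS : u ∉ S := fun h => ((hS u).1 h).1 rfl
  have hvS : v ∉ S := fun h => ((hS v).1 h).2.1 rfl
  have memF : ∀ ρ, ρ ∈ F ↔ ρ u = 0 ∧ ρ v = 1 := fun ρ => by rw [hF, mem_filter]; simp
  -- (1) deficit cells are −1
  have hDval : ∀ ρ ∈ D, K.resCell y S ρ = -1 := fun ρ hρ => by
    rw [hD, mem_filter] at hρ
    exact resCell_eq_neg_one_of_neg hS huv hyu hyv hmy hyu' htwo ρ ((memF ρ).1 hρ.1).1 ((memF ρ).1 hρ.1).2 hρ.2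
  -- (2) payers: ψ ρ ∈ F and resCell (ψ ρ) ≥ 1
  have hpay : ∀ ρ ∈ D, psi u S ρ ∈ F ∧ 1 ≤ K.resCell y S (psi u S ρ) := by
    intro ρ hρ
    rw [hD, mem_filter] at hρ
    obtain ⟨hu, hv⟩ := (memF ρ).1 hρ.1
    have hφu : phiU u ρ u = 0 := by rw [phiU_self, hu]
    have hφv : phiU u ρ v = 1 := by rw [phiU_of_ne u ρ huv.symm, hv]; decide
    rcases resCell_neg_cases hS huv hyu hyv hmy hyu' htwo ρ hu hv hρ.2 with
      ⟨hall, hu1, hv0, ht⟩ | ⟨hall, hu1, ht⟩ | ⟨s₀, hs₀, hc₀, hm₀, hrest, hv0, ht⟩ | ⟨s₀, hs₀, hc₀, hm₀, hrest, hv0, ht⟩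
    · rw [psi_of_all ρ (Or.inl hall)]
      exact ⟨(memF _).2 ⟨hφu, hφv⟩, by rw [resCell_phiU_of_D1 hS huv hyu hyv hmy hyu' hne ρ hu hv hall hv0 ht]; decide⟩
    · rw [psi_of_all ρ (Or.inr hall)]
      exact ⟨(memF _).2 ⟨hφu, hφv⟩, by rw [resCell_phiU_of_D2 hS huv hyu hyv hmy htwo ρ hu hv hall hu1 ht]; decide⟩
    · obtain ⟨hs₀u, hs₀v, -, -⟩ := (hS s₀).1 hs₀
      rw [psi_of_D4 htwo ρ hs₀ hc₀ hrest]
      refine ⟨(memF _).2 ⟨by rw [Function.update_of_ne hs₀u.symm, hu], by rw [Function.update_of_ne hs₀v.symm, hv]⟩, ?_⟩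
      rw [resCell_sibling_of_D4 hS huv hyu hyv hmy hyu' htwo ρ hu hv hs₀ hc₀ hm₀ hrest hv0 ht]; decide
    · obtain ⟨hs₀u, hs₀v, -, -⟩ := (hS s₀).1 hs₀
      rw [psi_of_D5 htwo ρ hs₀ hc₀ hrest]
      exact ⟨(memF _).2 ⟨by rw [Function.update_of_ne hs₀u.symm, hφu], by rw [Function.update_of_ne hs₀v.symm, hφv]⟩,
        one_le_resCell_partner_of_D5 hS huv hyu hyv hmy hyu' htwo ρ hu hv hs₀ hc₀ hm₀ hrest hv0 ht⟩
  -- (3) injectivity of ψ on D: an explicit left inverse by pattern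
  have hinj : Set.InjOn (psi u S) D := by
    intro ρ₁ h₁ ρ₂ h₂ heq
    rw [mem_coe, hD, mem_filter] at h₁ h₂
    obtain ⟨hu₁, hv₁⟩ := (memF ρ₁).1 h₁.1
    obtain ⟨hu₂, hv₂⟩ := (memF ρ₂).1 h₂.1
    -- patterns of the images on S
    have pat : ∀ ρ : V → Fin 3, ρ u = 0 → ρ v = 1 → K.resCell y S ρ < 0 →
        ((∀ s ∈ S, ρ s = 2) ∧ psi u S ρ = phiU u ρ ∧ (∀ s ∈ S, psi u S ρ s = 0)) ∨
        ((∀ s ∈ S, ρ s = 1) ∧ psi u S ρ = phiU u ρ ∧ (∀ s ∈ S, psi u S ρ s = 1)) ∨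
        (∃ s₀ ∈ S, ρ s₀ = 2 ∧ (∀ s ∈ S, s ≠ s₀ → ρ s = 0) ∧ psi u S ρ = Function.update ρ s₀ 1 ∧
            psi u S ρ s₀ = 1 ∧ (∀ s ∈ S, s ≠ s₀ → psi u S ρ s = 0)) ∨
        (∃ s₀ ∈ S, ρ s₀ = 1 ∧ (∀ s ∈ S, s ≠ s₀ → ρ s = 0) ∧ psi u S ρ = Function.update (phiU u ρ) s₀ 0 ∧
            psi u S ρ s₀ = 0 ∧ (∀ s ∈ S, s ≠ s₀ → psi u S ρ s = 2)) := by
      intro ρ hu hv hneg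
      rcases resCell_neg_cases hS huv hyu hyv hmy hyu' htwo ρ hu hv hneg with
        ⟨hall, -, -, -⟩ | ⟨hall, -, -⟩ | ⟨s₀, hs₀, hc₀, -, hrest, -, -⟩ | ⟨s₀, hs₀, hc₀, -, hrest, -, -⟩
      · refine Or.inl ⟨hall, psi_of_all ρ (Or.inl hall), fun s hs => ?_⟩
        rw [psi_of_all ρ (Or.inl hall), phiU_of_ne u ρ (fun h => huS (h ▸ hs)), hall s hs]; decide
      · refine Or.inr (Or.inl ⟨hall, psi_of_all ρ (Or.inr hall), fun s hs => ?_⟩)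
        rw [psi_of_all ρ (Or.inr hall), phiU_of_ne u ρ (fun h => huS (h ▸ hs)), hall s hs]; decide
      · refine Or.inr (Or.inr (Or.inl ⟨s₀, hs₀, hc₀, hrest, psi_of_D4 htwo ρ hs₀ hc₀ hrest, ?_, fun s hs hss => ?_⟩))
        · rw [psi_of_D4 htwo ρ hs₀ hc₀ hrest, Function.update_self]
        · rw [psi_of_D4 htwo ρ hs₀ hc₀ hrest, Function.update_of_ne hss, hrest s hs hss]
      · refine Or.inr (Or.inr (Or.inr ⟨s₀, hs₀, hc₀, hrest, psi_of_D5 htwo ρ hs₀ hc₀ hrest, ?_, fun s hs hss => ?_⟩))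
        · rw [psi_of_D5 htwo ρ hs₀ hc₀ hrest, Function.update_self]
        · rw [psi_of_D5 htwo ρ hs₀ hc₀ hrest, Function.update_of_ne hss, phiU_of_ne u ρ (fun h => huS (h ▸ hs)), hrest s hs hss]; decide
    obtain ⟨s₁, hs₁⟩ := hne
    have two : ∀ s₀ ∈ S, ∃ s ∈ S, s ≠ s₀ := fun s₀ _ => by
      by_contra hno; push Not at hno
      have : S.card ≤ 1 := card_le_one.2 fun a ha b hb => by rw [hno a ha, hno b hb]
      omega
    rcases pat ρ₁ hu₁ hv₁ h₁.2 with ⟨a1, e1, p1⟩ | ⟨a1, e1, p1⟩ | ⟨s₀, hs₀, c1, r1, e1, p1, q1⟩ | ⟨s₀, hs₀, c1, r1, e1, p1, q1⟩ <;>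
      rcases pat ρ₂ hu₂ hv₂ h₂.2 with ⟨a2, e2, p2⟩ | ⟨a2, e2, p2⟩ | ⟨t₀, ht₀, c2, r2, e2, p2, q2⟩ | ⟨t₀, ht₀, c2, r2, e2, p2, q2⟩
    -- 16 combinations: equal patterns ⇒ recover; different patterns ⇒ contradiction via a vertex of S
    · rw [e1, e2] at heq; have := congrArg (phiU u) heq; rwa [phiU_phiU, phiU_phiU] at this
    · exfalso; have := p1 s₁ hs₁; rw [heq, p2 s₁ hs₁] at this; exact absurd this (by decide)
    · exfalso; have := p1 t₀ ht₀; rw [heq, p2] at this; exact absurd this (by decide)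
    · exfalso; obtain ⟨s, hs, hss⟩ := two t₀ ht₀; have := p1 s hs; rw [heq, q2 s hs hss] at this; exact absurd this (by decide)
    · exfalso; have := p1 s₁ hs₁; rw [heq, p2 s₁ hs₁] at this; exact absurd this (by decide)
    · rw [e1, e2] at heq; have := congrArg (phiU u) heq; rwa [phiU_phiU, phiU_phiU] at this
    · exfalso; obtain ⟨s, hs, hss⟩ := two t₀ ht₀; have := p1 s hs; rw [heq, q2 s hs hss] at this; exact absurd this (by decide)
    · exfalso; have := p1 t₀ ht₀; rw [heq, p2] at this; exact absurd this (by decide)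
    · exfalso; have := p2 s₀ hs₀; rw [← heq, p1] at this; exact absurd this (by decide)
    · exfalso; obtain ⟨s, hs, hss⟩ := two s₀ hs₀; have := p2 s hs; rw [← heq, q1 s hs hss] at this; exact absurd this (by decide)
    · -- both D4: s₀ = t₀ then ρ₁ = ρ₂
      have hst : s₀ = t₀ := by
        by_contra hne; have := q2 s₀ hs₀ hne; rw [← heq, p1] at this; exact absurd this (by decide)
      subst hst
      funext w
      by_cases hw : w = s₀
      · rw [hw, c1, c2]
      · have := congrFun heq w; rwa [e1, e2, Function.update_of_ne hw, Function.update_of_ne hw] at this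
    · exfalso; have := p1; rw [heq] at this
      by_cases hst : s₀ = t₀
      · rw [hst, p2] at this; exact absurd this (by decide)
      · rw [q2 s₀ hs₀ hst] at this; exact absurd this (by decide)
    · exfalso; obtain ⟨s, hs, hss⟩ := two s₀ hs₀; have := p2 s hs; rw [← heq, q1 s hs hss] at this; exact absurd this (by decide)
    · exfalso; obtain ⟨s, hs, hss⟩ := two s₀ hs₀; have := p2 s hs; rw [← heq, q1 s hs hss] at this; exact absurd this (by decide)
    · exfalso; have := p2; rw [← heq] at this
      by_cases hst : t₀ = s₀
      · rw [hst, p1] at this; exact absurd this (by decide)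
      · rw [q1 t₀ ht₀ hst] at this; exact absurd this (by decide)
    · -- both D5
      have hst : s₀ = t₀ := by
        by_contra hne; have := q2 s₀ hs₀ hne; rw [← heq, p1] at this; exact absurd this (by decide)
      subst hst
      have hφ : phiU u ρ₁ = phiU u ρ₂ := by
        funext w
        by_cases hw : w = s₀
        · rw [hw, phiU_of_ne u ρ₁ ((hS s₀).1 hs₀).1, phiU_of_ne u ρ₂ ((hS s₀).1 hs₀).1, c1, c2]
        · have := congrFun heq w; rwa [e1, e2, Function.update_of_ne hw, Function.update_of_ne hw] at this
      have := congrArg (phiU u) hφ; rwa [phiU_phiU, phiU_phiU] at this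
  -- (4) assembly
  have hDsub : D ⊆ F := filter_subset _ _
  have hsplit : ∑ ρ ∈ F, K.resCell y S ρ = ∑ ρ ∈ D, K.resCell y S ρ + ∑ ρ ∈ F \ D, K.resCell y S ρ := by
    rw [← sum_sdiff hDsub, add_comm]
  have hDsum : ∑ ρ ∈ D, K.resCell y S ρ = -(D.card : ℤ) := by
    rw [sum_congr rfl hDval, sum_const]; simp
  have himg_sub : D.image (psi u S) ⊆ F \ D := by
    intro σ hσ
    rw [mem_image] at hσ
    obtain ⟨ρ, hρ, rfl⟩ := hσ
    obtain ⟨hF1, h1⟩ := hpay ρ hρ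
    rw [mem_sdiff]
    refine ⟨hF1, fun hmem => ?_⟩
    have hlt : K.resCell y S (psi u S ρ) < 0 := by
      simp only [hD, mem_filter] at hmem; exact hmem.2
    omega
  have hrest_nonneg : ∀ ρ ∈ F \ D, 0 ≤ K.resCell y S ρ := fun ρ hρ => by
    have hρF := (mem_sdiff.1 hρ).1
    have hρD := (mem_sdiff.1 hρ).2
    by_contra hlt; push Not at hlt
    exact hρD (by simp only [hD, mem_filter]; exact ⟨hρF, hlt⟩)
  have h2 : ∑ σ ∈ D.image (psi u S), K.resCell y S σ ≤ ∑ ρ ∈ F \ D, K.resCell y S ρ :=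
    sum_le_sum_of_subset_of_nonneg himg_sub (fun ρ hρ _ => hrest_nonneg ρ hρ)
  have h3 : ((D.image (psi u S)).card : ℤ) ≤ ∑ σ ∈ D.image (psi u S), K.resCell y S σ := by
    rw [card_eq_sum_ones, Nat.cast_sum]
    refine sum_le_sum fun σ hσ => ?_
    rw [mem_image] at hσ
    obtain ⟨ρ, hρ, rfl⟩ := hσ
    simpa using (hpay ρ hρ).2
  have h4 : (D.image (psi u S)).card = D.card := card_image_of_injOn hinj
  rw [hsplit, hDsum]
  have : (D.card : ℤ) ≤ ∑ ρ ∈ F \ D, K.resCell y S ρ := by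
    calc (D.card : ℤ) = ((D.image (psi u S)).card : ℤ) := by rw [h4]
      _ ≤ _ := h3
      _ ≤ _ := h2
  linarith

end Heart

end MGraph

end Summit.CriticalPhenomena.PercolationContinuityZ3.Theorems.SunflowerPartition.Kempe
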